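import Summits.CriticalPhenomena.PercolationContinuityZ3.Theses.PercNearOneGluing
import Literature.Probability.Percolation.PercolationEvents
import Literature.Probability.LatticeModels.ProdBernoulliIndependence
import HarnessLib.Audit

/-! TTRL-lite variant V2366 of stmt-CriticalPhenomena-4574 -/

namespace Summit.CriticalPhenomena.PercolationContinuityZ3.Theorems

open MeasureTheory Set Literature.Probability.LatticeModels Literature.Probability.Percolation
open scoped Classical BigOperators

/-- TTRL-lite variant V2366 (`n := 2`) of the shortening step of stmt-CriticalPhenomena-4574.
On `Fin 2`, once the edge `s(v, x)` carries weight `1` it is almost surely open, so `v ↔ b` has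
probability `1` for every `b : Fin 2`, and the gluing inequality reads
`P(⋃) · P(a₀ ↔ b) ≤ 1 ≤ P(v ↔ b)`. -/
theorem stub_shorteningStep_var2366 :
    ∀ (w : Sym2 (Fin 2) → unitInterval) (A : Finset (Fin 2)) (b v x a₀ : Fin 2), v ∉ A → v ≠ x →
      w s(v, x) = 0 → a₀ ∈ A →
      (∀ a ∈ A, (prodBernoulli w).real (openConn a₀ b) ≤ (prodBernoulli w).real (openConn a b)) →
      (∀ w' : Sym2 (Fin 2) → unitInterval, (∀ e, w e = 0 → w' e = 0) →
        ∀ (A' : Finset (Fin 2)) (o' b' : Fin 2) (t : ℝ),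
          (∀ a ∈ A', t ≤ (prodBernoulli w').real (openConn a b')) →
          (prodBernoulli w').real (⋃ a ∈ A', openConn o' a) * t ≤
            (prodBernoulli w').real (openConn o' b')) →
      (prodBernoulli (Function.update w s(v, x) 1)).real (⋃ a ∈ A, openConn v a) *
          (prodBernoulli (Function.update w s(v, x) 1)).real (openConn a₀ b) ≤
        (prodBernoulli (Function.update w s(v, x) 1)).real (openConn v b) := by
  have key : ∀ b v x : Fin 2, v ≠ x → ¬ b = v → b = x := by decide
  intro w A b v x a₀ _ hvx _ _ _ _
  -- the edge `s(v, x)` is almost surely open under the updated weights, and then `v ↔ b`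
  have hsub : {ω : Set (Sym2 (Fin 2)) | s(v, x) ∈ ω} ⊆ openConn v b := by
    intro ω hω
    change (openGraph ω).Reachable v b
    by_cases hb : b = v
    · rw [hb]
    · rw [key b v x hvx hb]
      exact SimpleGraph.Adj.reachable ((openGraph_adj ω v x).2 ⟨hω, hvx⟩)
  have h1 : (1 : ℝ) ≤ (prodBernoulli (Function.update w s(v, x) 1)).real (openConn v b) := by
    calc (1 : ℝ) = ((Function.update w s(v, x) 1 s(v, x) : unitInterval) : ℝ) := by simp
      _ = (prodBernoulli (Function.update w s(v, x) 1)).real {ω | s(v, x) ∈ ω} :=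
          (prodBernoulli_real_setOf_mem _ _).symm
      _ ≤ (prodBernoulli (Function.update w s(v, x) 1)).real (openConn v b) :=
          measureReal_mono hsub
  calc (prodBernoulli (Function.update w s(v, x) 1)).real (⋃ a ∈ A, openConn v a) *
          (prodBernoulli (Function.update w s(v, x) 1)).real (openConn a₀ b)
        ≤ 1 * 1 := mul_le_mul measureReal_le_one measureReal_le_one measureReal_nonneg zero_le_one
    _ = 1 := one_mul 1
    _ ≤ _ := h1

end Summit.CriticalPhenomena.PercolationContinuityZ3.Theorems
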